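import Summits.BirchSwinnertonDyer.BirchSwinnertonDyer.Theorems.PrintCFramBottomClassIndexLawFiveLeKummerTwoCharacters
import Summits.BirchSwinnertonDyer.BirchSwinnertonDyer.Theorems.PrintCFramBottomClassIndexLawFiveLeHerbrandKummerReflectionCountEvenCharacters
import Literature.Geometry.Kaehler.ComplexTorusTateModuleIsogeny
import HarnessLib

/-!
# Route `PrintCFram`, crux C2 `BottomClassIndexLawFiveLe` (stmt-BirchSwinnertonDyer-20372), line
# `eisenstein-resource-bdp-line` (B1 first-order census, CASE R): **FROM THE `θ`-COMPONENT TO AN EVEN EIGENCLASS** —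
# `e_θ(ℤ_p ⊗ Cl K) ≠ 0 ⟹ ∃ x ∈ Cl(K)[p] ∖ {1}` with `σ·x = e(σ) x` exactly, and the component-currency form of
# «EVEN-IRREGULAR ⟹ two independent admissible Kummer characters»
# (cell `bsd-print-cfram`, width seat `bsd-line-cfram-p1-w7` g4; helper `--supports` 20372; 0 defs, 0 facts, 0 sorry)

HONEST FRAMING. Nothing about BSD is proved here; no summit statement is proved by this seat; no stub of the registered
skeleton is closed. This file converts currencies: the successor item of w2 g10 (00:00:48Z) states even-irregularity as
`#e_{θ}(ℤ_p ⊗ Cl K) ≠ 1` (`classGroupChiCard`, the currency of `ClassGroupUnitsGaloisModules` and of the Gras / Mazur–Wiles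
named facts), whereas the class-radical construction `KummerRadical.exists_eigenRadical_of_eigenclass` and
`exists_two_independent_kummer_characters` (this seat, p683707 / p684186) take an EIGENCLASS `x : Cl(𝓞 K)`, `x ≠ 1`, `x^p = 1`,
`σ·x = e σ • x`. The converse bridge `eigenclass_eq_one_of_classGroupChiComponent_eq_bot` (w8 g0) goes the other way; w6 g2's
`exists_eigen_mod_not_mem_smul_of_chiComponent_ne_bot` produces an eigenvector of `Cl/p`, not of `Cl[p]`.

* `exists_mem_ne_zero_prime_smul_eq_zero` — a non-zero element of a `ℤ_p`-submodule of a finite `p`-power-order group has a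
  non-zero multiple killed by `p` inside the submodule;
* **`exists_eigenclass_of_classGroupChiComponent_ne_bot`** — `K/ℚ` Galois, `p ∤ [K:ℚ]`, `θ : Gal(K/ℚ) →* ℤ_pˣ` with integer
  shadow `e` (`‖θ σ − e σ‖ < 1`): `e_θ(ℤ_p ⊗ Cl(𝓞 K)) ≠ ⊥ ⟹ ∃ x : Cl(𝓞 K)`, `x ≠ 1`, `x ^ p = 1`, `σ·x = e σ • x` for all `σ`.
  Proof: a non-zero `y` of the component with `p y = 0`; `y = 1 ⊗ ν` with `ν` in the `p`-primary part
  (`exists_mem_primaryComponent_toPadicTensor_eq`); `p ν` and `σ ν − e(σ) ν` lie in the `p`-primary part and die under `1 ⊗ −`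
  (`y` is a `θ`-eigenvector by `mem_chiComponent_character_iff`, and `(θ σ − e σ) y ∈ p ℤ_p y = 0`), so they vanish
  (`toPadicTensor_injOn`);
* `exists_eigenclass_of_classGroupChiCard_ne_one` — the same from `classGroupChiCard ℚ K p θ ≠ 1`;
* **`exists_two_independent_kummer_characters_of_classGroupChiCard_ne_one`** — `K` CM, Galois/ℚ, `p ∤ [K:ℚ]`, `ζ ∈ K` a primitive
  `p`-th root of unity with cyclotomic exponents `a`, `θ ≠ 1` even with shadow `e`, and `#e_θ(ℤ_p ⊗ Cl K) ≠ 1`: the conclusion of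
  `exists_two_independent_kummer_characters` (two characters `Γ_K →* ℤ/p`, open kernels, unramified at the inertia above every
  `v ∤ p`, `ā ē⁻¹`-isotypic under `absGaloisOuterConj`, jointly independent).

* §4 (APPENDED) **`exists_two_independent_kummer_characters_of_odd_character`** — the same in the REFLECTION-PAIR currency
  of `HerbrandKummer.finite_and_natCard_le_prime_mul_classGroupChiCard_of_odd_characters` (the upper bound): data `χ̄` ODD
  (`χ̄(c) = −1`), `ψ̄ = ā χ̄⁻¹ ≠ 1`, `#e_{ω∘ψ̄}(ℤ_p ⊗ Cl K) ≠ 1` (`teichmullerChar p ∘ ψ̄`) ⊢ two independent admissible characters,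
  isotypic with exponent `(χ̄ γ̄).val` — so that LOWER (`p² ≤ #V`, w2 g11's `sq_le_natCard_closure_pair`) and UPPER
  (`#V ≤ p · #e_θ(ℤ_p ⊗ Cl K)`) bounds speak about the same `V` with the same hypotheses.

References: [Washington1997] §6.3, §10.2 (components `ε_i A`); [Lang1990] Ch. 1 §3; [Lang1983AbelianVarieties] Ch. VII §1
(`N(p) = ℤ_p ⊗ N`).
-/

set_option autoImplicit false
-- `…BirchSwinnertonDyer.BirchSwinnertonDyer.Theorems…` is the problem's mandated namespace (D-0017).
set_option linter.dupNamespace false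

noncomputable section

namespace Summit.BirchSwinnertonDyer.BirchSwinnertonDyer.Theorems.PrintCFram.KummerRadical

open Literature.NumberTheory.NumberFields Literature.RepresentationTheory.FiniteGroups
open Literature.NumberTheory.GaloisRepresentations
open Literature.Geometry.Kaehler.FiniteAddGroup
open NumberField IsDedekindDomain Field Module
open scoped TensorProduct

/-! ## §1 An element of order `p` in a non-zero submodule -/

section OrderP

variable {p : ℕ} [hp : Fact p.Prime] {V : Type*} [AddCommGroup V] [Module ℤ_[p] V]

/-- In a `ℤ_p`-module `V` of finite `p`-power cardinality, a non-zero element `y` of a submodule `C` has a multiple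
`y' = p^j y ∈ C` with `y' ≠ 0` and `p • y' = 0`. [folklore] -/
theorem exists_mem_ne_zero_prime_smul_eq_zero {n : ℕ} (hV : Nat.card V = p ^ n) (C : Submodule ℤ_[p] V) {y : V}
    (hyC : y ∈ C) (hy0 : y ≠ 0) : ∃ y' ∈ C, y' ≠ 0 ∧ (p : ℤ_[p]) • y' = 0 := by
  classical
  have hfin : Finite V := Nat.finite_of_card_ne_zero (by rw [hV]; exact pow_ne_zero _ hp.out.ne_zero)
  -- the additive order of `y` is `p ^ k`, `k ≥ 1`
  have hdvd : addOrderOf y ∣ p ^ n := hV ▸ addOrderOf_dvd_natCard y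
  obtain ⟨k, -, hk⟩ := (Nat.dvd_prime_pow hp.out).1 hdvd
  have hk0 : k ≠ 0 := by
    rintro rfl
    rw [pow_zero, AddMonoid.addOrderOf_eq_one_iff] at hk
    exact hy0 hk
  refine ⟨(p ^ (k - 1) : ℕ) • y, C.smul_of_tower_mem _ hyC, ?_, ?_⟩
  · refine nsmul_ne_zero_of_lt_addOrderOf (pow_ne_zero _ hp.out.ne_zero) ?_
    rw [hk]
    exact Nat.pow_lt_pow_right hp.out.one_lt (by omega)
  · rw [Nat.cast_smul_eq_nsmul ℤ_[p], ← mul_nsmul', ← pow_succ', Nat.sub_add_cancel (Nat.one_le_iff_ne_zero.2 hk0), ← hk,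
      addOrderOf_nsmul_eq_zero]

end OrderP

/-! ## §2 From the `θ`-component to an eigenclass -/

section Eigenclass

variable {K : Type} [Field K] [NumberField K] [IsGalois ℚ K] {p : ℕ} [hp : Fact p.Prime]

/-- **An even (or odd) eigenclass from a non-zero `θ`-component.** Let `K/ℚ` be Galois with `p ∤ [K : ℚ]`,
`θ : Gal(K/ℚ) →* ℤ_pˣ` and `e : Gal(K/ℚ) → ℕ` with `‖θ σ − e σ‖ < 1`. If `e_θ(ℤ_p ⊗ Cl(𝓞 K)) ≠ ⊥`
(`classGroupChiComponent ℚ K p θ ≠ ⊥`), then there is an ideal class `x ≠ 1` with `x ^ p = 1` and `σ · x = e σ • x` for every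
`σ ∈ Gal(K/ℚ)` — a non-trivial `θ̄`-eigenclass in `Cl(K)[p]` («`ε_i A ≠ 0 ⟹ A[p]` has a non-trivial `ω^i`-eigenvector»).
[cite: Washington1997, §6.3 and §10.2] [cite: Lang1983AbelianVarieties, Ch. VII §1, Theorem 1 (proof), p. 182] -/
theorem exists_eigenclass_of_classGroupChiComponent_ne_bot (hpK : ¬ p ∣ Module.finrank ℚ K)
    (θ : (K ≃ₐ[ℚ] K) →* ℤ_[p]ˣ) (e : (K ≃ₐ[ℚ] K) → ℕ)
    (hθe : ∀ σ : K ≃ₐ[ℚ] K, ‖((θ σ : ℤ_[p]ˣ) : ℤ_[p]) - (e σ : ℤ_[p])‖ < 1)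
    (hne : classGroupChiComponent ℚ K p (fun g => ((θ g : ℤ_[p]ˣ) : ℤ_[p])) ≠ ⊥) :
    ∃ x : ClassGroup (𝓞 K), x ≠ 1 ∧ x ^ p = 1 ∧
      ∀ σ : K ≃ₐ[ℚ] K, classGroupRep ℚ K σ (Additive.ofMul x) = e σ • Additive.ofMul x := by
  classical
  set N := Additive (ClassGroup (𝓞 K)) with hN
  set C := classGroupChiComponent ℚ K p (fun g => ((θ g : ℤ_[p]ˣ) : ℤ_[p])) with hC
  -- a non-zero `y ∈ C` with `p y = 0`
  obtain ⟨y₀, hy₀C, hy₀0⟩ := (Submodule.ne_bot_iff C).1 hne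
  obtain ⟨y, hyC, hy0, hpy⟩ := exists_mem_ne_zero_prime_smul_eq_zero (natCard_padicIntTensor N p) C hy₀C hy₀0
  -- `y` is a `θ`-eigenvector, and `θ σ • y = e σ • y`
  have hG : IsUnit (Fintype.card (K ≃ₐ[ℚ] K) : ℤ_[p]) := by
    rw [← Nat.card_eq_fintype_card, IsGalois.card_aut_eq_finrank, PadicInt.isUnit_iff, PadicInt.norm_natCast_eq_one_iff]
    exact (Nat.Prime.coprime_iff_not_dvd hp.out).2 hpK
  have heig : ∀ σ : K ≃ₐ[ℚ] K, pClassGroupRep ℚ K p σ y = (e σ : ℤ_[p]) • y := by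
    intro σ
    rw [(mem_chiComponent_character_iff (pClassGroupRep ℚ K p) θ hG y).1 hyC σ]
    obtain ⟨w, hw⟩ := (PadicInt.norm_lt_one_iff_dvd _).1 (hθe σ)
    have h1 : (((θ σ : ℤ_[p]ˣ) : ℤ_[p]) - (e σ : ℤ_[p])) • y = 0 := by
      rw [hw, mul_comm, mul_smul, hpy, smul_zero]
    rwa [sub_smul, sub_eq_zero] at h1
  -- `y = 1 ⊗ ν`, `ν` in the `p`-primary part
  obtain ⟨ν, hνP, hνy⟩ := exists_mem_primaryComponent_toPadicTensor_eq (N := N) (p := p) y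
  have hinj := toPadicTensor_injOn (N := N) (p := p)
  -- the subgroup `N(p)` is stable under `Gal(K/ℚ)` and multiples
  have hstab : ∀ (σ : K ≃ₐ[ℚ] K) (v : N), v ∈ AddCommGroup.primaryComponent N p →
      classGroupRep ℚ K σ v ∈ AddCommGroup.primaryComponent N p := by
    intro σ v hv
    obtain ⟨k, hk⟩ := (AddCommGroup.mem_primaryComponent).1 hv
    exact (AddCommGroup.mem_primaryComponent).2 ⟨k, by rw [← map_nsmul, hk, map_zero]⟩
  refine ⟨Additive.toMul ν, ?_, ?_, ?_⟩
  · -- `x ≠ 1`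
    intro h1
    have hν0 : ν = 0 := by rw [← ofMul_toMul ν, h1, ofMul_one]
    rw [hν0, map_zero] at hνy
    exact hy0 hνy.symm
  · -- `x ^ p = 1`: `1 ⊗ (p ν) = p y = 0`
    have hpν : p • ν = 0 := by
      refine hinj (AddSubgroup.nsmul_mem _ hνP p) (zero_mem _) ?_
      rw [map_nsmul, hνy, map_zero, ← Nat.cast_smul_eq_nsmul ℤ_[p], hpy]
    have h := congrArg Additive.toMul hpν
    rwa [toMul_nsmul, toMul_zero] at h
  · -- eigen-relation: `1 ⊗ (σ ν − e σ ν) = θ σ y − e σ y = 0`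
    intro σ
    rw [ofMul_toMul]
    have hmem : classGroupRep ℚ K σ ν - e σ • ν ∈ AddCommGroup.primaryComponent N p :=
      sub_mem (hstab σ ν hνP) (AddSubgroup.nsmul_mem _ hνP _)
    have hzero : classGroupRep ℚ K σ ν - e σ • ν = 0 := by
      refine hinj hmem (zero_mem _) ?_
      rw [map_sub, map_nsmul, map_zero, sub_eq_zero, hνy, toPadicTensor_apply, ← baseChangeRep_apply_tmul ℤ_[p],
        ← toPadicTensor_apply N p ν, hνy, ← Nat.cast_smul_eq_nsmul ℤ_[p]]
      exact heig σ
    exact sub_eq_zero.1 hzero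

/-- The same from the CARDINALITY currency: `#e_θ(ℤ_p ⊗ Cl(𝓞 K)) ≠ 1` (`classGroupChiCard ℚ K p θ ≠ 1`) gives a non-trivial
`θ̄`-eigenclass in `Cl(K)[p]`. [cite: Washington1997, §6.3 and §10.2] -/
theorem exists_eigenclass_of_classGroupChiCard_ne_one (hpK : ¬ p ∣ Module.finrank ℚ K)
    (θ : (K ≃ₐ[ℚ] K) →* ℤ_[p]ˣ) (e : (K ≃ₐ[ℚ] K) → ℕ)
    (hθe : ∀ σ : K ≃ₐ[ℚ] K, ‖((θ σ : ℤ_[p]ˣ) : ℤ_[p]) - (e σ : ℤ_[p])‖ < 1)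
    (hne : classGroupChiCard ℚ K p (fun g => ((θ g : ℤ_[p]ˣ) : ℤ_[p])) ≠ 1) :
    ∃ x : ClassGroup (𝓞 K), x ≠ 1 ∧ x ^ p = 1 ∧
      ∀ σ : K ≃ₐ[ℚ] K, classGroupRep ℚ K σ (Additive.ofMul x) = e σ • Additive.ofMul x := by
  refine exists_eigenclass_of_classGroupChiComponent_ne_bot hpK θ e hθe fun hbot => hne ?_
  rw [classGroupChiCard, hbot]
  exact Nat.card_unique

end Eigenclass

/-! ## §3 EVEN-IRREGULAR (component currency) ⟹ two independent admissible characters -/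

section TwoCharacters

variable {K : Type} [Field K] [NumberField K] [IsCMField K] [IsGalois ℚ K] {p : ℕ} [hp : Fact p.Prime]

/-- **EVEN-IRREGULAR ⟹ two independent admissible Kummer characters (component currency).** Let `K` be a CM field, Galois
over `ℚ` with `p ∤ [K : ℚ]`, containing a primitive `p`-th root of unity `ζ` with cyclotomic exponents `a` (`σ ζ = ζ^{a σ}`); let
`θ : Gal(K/ℚ) →* ℤ_pˣ` be EVEN (`θ(c) = 1`), `θ ≠ 1`, with integer shadow `e` (`‖θ σ − e σ‖ < 1`), and suppose the
`θ`-part of the `p`-class group is non-trivial: `#e_θ(ℤ_p ⊗ Cl(𝓞 K)) ≠ 1`. Then there are two characters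
`κ₁, κ₂ : Γ_K →* ℤ/p` with open kernels, trivial on the inertia group of every prime of `K̄` above every `v ∤ p`, transforming
under `absGaloisOuterConj ℚ K γ` by the exponent `a(γ̄) e(γ̄)⁻¹`, and independent (`κ₁^i κ₂^j = 1 ⟹ p ∣ i ∧ p ∣ j`): the Kummer
characters of the Minkowski `θ`-eigenunit and of the radical of a `θ̄`-eigenclass. This is the number-theoretic input of the
lower bound `#H¹_{S_p-rel}(ℚ, 𝔽_p(ω θ̄⁻¹)) ≥ p²` in the even-irregular case.
[cite: Washington1997, §10.2 (Thm. 10.9, proof) and §6.3] [cite: Gras2003, Ch. II §5 (reflection theorem)] -/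
theorem exists_two_independent_kummer_characters_of_classGroupChiCard_ne_one (hpK : ¬ p ∣ Module.finrank ℚ K) {ζ : K}
    (hζ : IsPrimitiveRoot ζ p) (a : (K ≃ₐ[ℚ] K) → ℕ) (ha : ∀ σ₀ : K ≃ₐ[ℚ] K, σ₀ ζ = ζ ^ a σ₀)
    (θ : (K ≃ₐ[ℚ] K) →* ℤ_[p]ˣ) (hθ1 : θ ≠ 1) (hθc : θ ((IsCMField.complexConj K).restrictScalars ℚ) = 1)
    (e : (K ≃ₐ[ℚ] K) → ℕ) (hθe : ∀ σ, ‖((θ σ : ℤ_[p]ˣ) : ℤ_[p]) - (e σ : ℤ_[p])‖ < 1)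
    (hne : classGroupChiCard ℚ K p (fun g => ((θ g : ℤ_[p]ˣ) : ℤ_[p])) ≠ 1) :
    ∃ κ₁ κ₂ : absoluteGaloisGroup K →* Multiplicative (ZMod p),
      (IsOpen (κ₁.ker : Set (absoluteGaloisGroup K)) ∧
        (∀ v : HeightOneSpectrum (𝓞 K), ((p : ℕ) : 𝓞 K) ∉ v.asIdeal →
          ∀ 𝔔 ∈ v.primesAbove, ∀ g ∈ 𝔔.inertia (absoluteGaloisGroup K), κ₁ g = 1) ∧
        ∀ (γ : absoluteGaloisGroup ℚ) (σ : absoluteGaloisGroup K),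
          κ₁ (absGaloisOuterConj ℚ K γ σ) = κ₁ σ ^ (a (absGaloisQuot ℚ K γ) * e (absGaloisQuot ℚ K γ)⁻¹)) ∧
      (IsOpen (κ₂.ker : Set (absoluteGaloisGroup K)) ∧
        (∀ v : HeightOneSpectrum (𝓞 K), ((p : ℕ) : 𝓞 K) ∉ v.asIdeal →
          ∀ 𝔔 ∈ v.primesAbove, ∀ g ∈ 𝔔.inertia (absoluteGaloisGroup K), κ₂ g = 1) ∧
        ∀ (γ : absoluteGaloisGroup ℚ) (σ : absoluteGaloisGroup K),
          κ₂ (absGaloisOuterConj ℚ K γ σ) = κ₂ σ ^ (a (absGaloisQuot ℚ K γ) * e (absGaloisQuot ℚ K γ)⁻¹)) ∧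
      ∀ i j : ℕ, κ₁ ^ i * κ₂ ^ j = 1 → p ∣ i ∧ p ∣ j := by
  obtain ⟨x, hx1, hxp, hxe⟩ := exists_eigenclass_of_classGroupChiCard_ne_one hpK θ e hθe hne
  exact exists_two_independent_kummer_characters hpK hζ a ha θ hθ1 hθc e hθe x hx1 hxp hxe

end TwoCharacters

/-! ## §4 The reflection-pair currency `(χ̄, ψ̄ = ā χ̄⁻¹)` (APPENDED) -/

section OddCharacter

open Literature.NumberTheory.EllipticCurves.Kato2004 HerbrandKummer

variable {K : Type} [Field K] [NumberField K] [IsCMField K] [IsGalois ℚ K] {p : ℕ} [hp : Fact p.Prime]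

/-- Exponents of an element of `Multiplicative (ZMod p)` only matter mod `p`. [folklore] -/
theorem multiplicative_zmod_pow_eq_pow_of_natCast_eq (x : Multiplicative (ZMod p)) {m n : ℕ}
    (h : (m : ZMod p) = (n : ZMod p)) : x ^ m = x ^ n := by
  have hxp : x ^ p = 1 := by
    have h1 : x ^ Nat.card (Multiplicative (ZMod p)) = 1 := pow_card_eq_one'
    rwa [Nat.card_congr Multiplicative.toAdd, Nat.card_zmod] at h1
  rw [pow_eq_pow_iff_modEq]
  exact ((ZMod.natCast_eq_natCast_iff m n p).1 h).of_dvd (orderOf_dvd_of_pow_eq_one hxp)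

/-- **EVEN-IRREGULAR ⟹ two independent admissible Kummer characters, reflection-pair currency.** Let `K` be a CM field,
Galois over `ℚ` with `p ∤ [K : ℚ]`, `ζ ∈ K` a primitive `p`-th root of unity with `σ ζ = ζ^{a σ}`; `χ̄ : Gal(K/ℚ) →* (ℤ/p)ˣ` ODD
(`χ̄(c) = −1`) and `ψ̄ : Gal(K/ℚ) →* (ℤ/p)ˣ` its reflection `ψ̄ σ = a σ · χ̄(σ)⁻¹` («`ω̄ χ̄⁻¹`», even), `ψ̄ ≠ 1`; and suppose the
`ω∘ψ̄`-part of the `p`-class group is non-trivial, `#e_{ω∘ψ̄}(ℤ_p ⊗ Cl(𝓞 K)) ≠ 1` (`ω∘ψ̄ = teichmullerChar p ∘ ψ̄`, the currency of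
`finite_and_natCard_le_prime_mul_classGroupChiCard_of_odd_characters`). Then there are `κ₁, κ₂ : Γ_K →* ℤ/p` with open kernels,
trivial on the inertia above every `v ∤ p`, `χ̄`-isotypic (`κ (θ_γ σ) = κ(σ)^{χ̄(γ̄)}`, exponent `(χ̄ γ̄).val`) and independent
(`κ₁^i κ₂^j = 1 ⟹ p ∣ i ∧ p ∣ j`). With the upper bound this pins `p² ≤ #V ≤ p · #e_{ω∘ψ̄}(ℤ_p ⊗ Cl K)` for the group `V` of
admissible `χ̄`-isotypic characters in the even-irregular case (Leopoldt's reflection, lower half).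
[cite: Washington1997, §10.2 (Thm. 10.9, proof)] [cite: Gras2003, Ch. II §5 (reflection theorem)] -/
theorem exists_two_independent_kummer_characters_of_odd_character (hpK : ¬ p ∣ Module.finrank ℚ K) {ζ : K}
    (hζ : IsPrimitiveRoot ζ p) (a : (K ≃ₐ[ℚ] K) → ℕ) (ha : ∀ σ₀ : K ≃ₐ[ℚ] K, σ₀ ζ = ζ ^ a σ₀)
    (χb : (K ≃ₐ[ℚ] K) →* (ZMod p)ˣ) (hoddχ : χb ((IsCMField.complexConj K).restrictScalars ℚ) = -1)
    (ψb : (K ≃ₐ[ℚ] K) →* (ZMod p)ˣ) (hψb1 : ψb ≠ 1)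
    (hψb : ∀ σ : K ≃ₐ[ℚ] K, ((ψb σ : (ZMod p)ˣ) : ZMod p) = (a σ : ZMod p) * (((χb σ)⁻¹ : (ZMod p)ˣ) : ZMod p))
    (hne : classGroupChiCard ℚ K p (fun g => ((((teichmullerChar p).comp ψb) g : ℤ_[p]ˣ) : ℤ_[p])) ≠ 1) :
    ∃ κ₁ κ₂ : absoluteGaloisGroup K →* Multiplicative (ZMod p),
      (IsOpen (κ₁.ker : Set (absoluteGaloisGroup K)) ∧
        (∀ v : HeightOneSpectrum (𝓞 K), ((p : ℕ) : 𝓞 K) ∉ v.asIdeal →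
          ∀ 𝔔 ∈ v.primesAbove, ∀ g ∈ 𝔔.inertia (absoluteGaloisGroup K), κ₁ g = 1) ∧
        ∀ (γ : absoluteGaloisGroup ℚ) (σ : absoluteGaloisGroup K),
          κ₁ (absGaloisOuterConj ℚ K γ σ) = κ₁ σ ^ ((χb (absGaloisQuot ℚ K γ) : (ZMod p)ˣ) : ZMod p).val) ∧
      (IsOpen (κ₂.ker : Set (absoluteGaloisGroup K)) ∧
        (∀ v : HeightOneSpectrum (𝓞 K), ((p : ℕ) : 𝓞 K) ∉ v.asIdeal →
          ∀ 𝔔 ∈ v.primesAbove, ∀ g ∈ 𝔔.inertia (absoluteGaloisGroup K), κ₂ g = 1) ∧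
        ∀ (γ : absoluteGaloisGroup ℚ) (σ : absoluteGaloisGroup K),
          κ₂ (absGaloisOuterConj ℚ K γ σ) = κ₂ σ ^ ((χb (absGaloisQuot ℚ K γ) : (ZMod p)ˣ) : ZMod p).val) ∧
      ∀ i j : ℕ, κ₁ ^ i * κ₂ ^ j = 1 → p ∣ i ∧ p ∣ j := by
  classical
  -- the even radical character `θ = ω ∘ ψ̄` and its integer shadow `e = val ∘ ψ̄`
  have hθe : ∀ σ : K ≃ₐ[ℚ] K, ‖((((teichmullerChar p).comp ψb) σ : ℤ_[p]ˣ) : ℤ_[p]) -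
      ((((ψb σ : (ZMod p)ˣ) : ZMod p).val : ℕ) : ℤ_[p])‖ < 1 := fun σ =>
    norm_teichmullerChar_comp_sub_lt_one ψb σ _ (ZMod.natCast_zmod_val _).symm
  have hθc : ((teichmullerChar p).comp ψb) ((IsCMField.complexConj K).restrictScalars ℚ) = 1 := by
    have h1 : ((ψb ((IsCMField.complexConj K).restrictScalars ℚ) : (ZMod p)ˣ) : ZMod p) = 1 := by
      rw [hψb, hoddχ, inv_neg_one, Units.val_neg, Units.val_one, natCast_cycloExp_complexConj hp.out hζ a ha]
      ring
    have h2 : ψb ((IsCMField.complexConj K).restrictScalars ℚ) = 1 := Units.ext (by rw [h1, Units.val_one])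
    rw [MonoidHom.comp_apply, h2, map_one]
  have hθ1 : (teichmullerChar p).comp ψb ≠ 1 := by
    intro h
    apply hψb1
    ext σ
    have h3 := DFunLike.congr_fun h σ
    rw [MonoidHom.comp_apply, MonoidHom.one_apply, ← (teichmullerChar p).map_one] at h3
    rw [teichmullerChar_injective p h3, MonoidHom.one_apply]
  obtain ⟨κ₁, κ₂, ⟨ho₁, hu₁, heq₁⟩, ⟨ho₂, hu₂, heq₂⟩, hind⟩ :=
    exists_two_independent_kummer_characters_of_classGroupChiCard_ne_one hpK hζ a ha ((teichmullerChar p).comp ψb) hθ1 hθc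
      (fun σ => ((ψb σ : (ZMod p)ˣ) : ZMod p).val) hθe hne
  -- the exponent `a(γ̄) · ψ̄(γ̄⁻¹) ≡ χ̄(γ̄) (mod p)`
  have hexp : ∀ τ : K ≃ₐ[ℚ] K,
      ((a τ * ((ψb τ⁻¹ : (ZMod p)ˣ) : ZMod p).val : ℕ) : ZMod p) = ((((χb τ : (ZMod p)ˣ) : ZMod p).val : ℕ) : ZMod p) := by
    intro τ
    have h1 : (a τ : ZMod p) = ((ψb τ : (ZMod p)ˣ) : ZMod p) * ((χb τ : (ZMod p)ˣ) : ZMod p) := by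
      rw [hψb τ, mul_assoc, Units.inv_mul, mul_one]
    rw [Nat.cast_mul, ZMod.natCast_zmod_val, ZMod.natCast_zmod_val, map_inv, h1, mul_right_comm, Units.mul_inv, one_mul]
  exact ⟨κ₁, κ₂, ⟨ho₁, hu₁, fun γ σ => (heq₁ γ σ).trans (multiplicative_zmod_pow_eq_pow_of_natCast_eq _ (hexp _))⟩,
    ⟨ho₂, hu₂, fun γ σ => (heq₂ γ σ).trans (multiplicative_zmod_pow_eq_pow_of_natCast_eq _ (hexp _))⟩, hind⟩

end OddCharacter

end Summit.BirchSwinnertonDyer.BirchSwinnertonDyer.Theorems.PrintCFram.KummerRadical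

end
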